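import Literature.NumberTheory.EllipticCurves.KubertTateSevenMuDescentBox
import Literature.NumberTheory.EllipticCurves.KubertTateSevenRationalTorsion
import HarnessLib

/-!
# `t₇ = 0` at rank `2` by descent alone: the Kubert–Tate `7`-torsion curve `E_{-11/5} = [-151, 9680, 242000, 0, 0]`

PROOF-ONLY file (theorems only, no definition, no named fact, no `sorry`), topic
`NumberTheory/EllipticCurves`; an INSTANCE of the `μ₇`-descent box criterion
(`KubertTateSevenMuDescent.shaCorank_seven_eq_zero_of_matrix` and siblings, files
`KubertTateSevenMuDescent[Box]`) on the Kubert–Tate `X₁(7)`-family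
`E_{m,n} : y² + (n² + mn − m²)xy + m²n³(n−m)y = x³ + m²n(n−m)x²`, at `(m, n) = (-11, 5)`:

  `E = E_{-11/5} = kubertTateSeven (-11) 5 = [-151, 9680, 242000, 0, 0]`, i.e. `y ^ 2 - 151 * x * y + 242000 * y = x ^ 3 + 9680 * x ^ 2`,
  `Δ = -2^28·5^7·11^7·41·181`, `T = (0,0)` of order `7`.

TAME: `7 ∤ Δ` and the bad primes `2, 5, 11, 41, 181` are `≢ 1 (mod 7)`. BOX: `S = {2, 5, 11}`
(`ω(mn(m−n)) = 3`); the rational points `(176, 1408)`, `(-528, 7744)`, `(2800, 416000)` (found by a naive search)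
have `f_T = x²y − n(m+n)x³ + n³(2m+n)xy − m²n⁴x² + m²n⁶y` equal to `15488`, `-10307264`, `1638400000000`, the base point
`2T = (-9680, -1703680)` has `f_T = -232202043392000`; the `3×3` matrix of valuation differences mod `7`,
`M = [[1, 4, 3], [0, 4, 6], [2, 5, 1]]`, is invertible mod `7` (inverse `[[6, 5, 1], [1, 6, 3], [4, 2, 5]]`). Hence, with NO `L`-function, `p`-adic or conjectural input:

* `shaCorank_seven_eq_zero` — **`t₇(E_{-11/5}) = corank_{ℤ₇} Ш(E/ℚ)[7^∞] = 0`**;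
* `sha_torsionBy_seven_eq_bot` — `Ш(E/ℚ)[7] = 0`; `primaryComponent_sha_seven_eq_bot` — `Ш(E/ℚ)[7^∞] = 0`;
* `mordellWeilRank_eq` — **`rank E_{-11/5}(ℚ) = 2`** (with `#E(ℚ)[7] = 7` by reduction modulo `3`,
  `KubertTateSevenTorsion.natCard_torsionBy_seven`).

## References

* [SilvermanAEC2009] J. H. Silverman, *AEC*, 2nd ed., Thm. X.4.2, Prop. X.4.9, Exercise 10.1, Thm. X.1.1,
  VII.3.1(b).
* [Fisher2001FiveSevenDescent] T. Fisher, *Some examples of 5 and 7 descent for elliptic curves over ℚ*,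
  JEMS 3 (2001), §§1–2 (the family; this member and its points are ours, verified in-file).
* [Kubert1976] D. S. Kubert, *Universal bounds on the torsion of elliptic curves*, Table 3 (`N = 7`).
-/

noncomputable section

open scoped AddSubgroup
open WeierstrassCurve
open Literature.NumberTheory.EllipticCurves Literature.NumberTheory.EllipticCurves.KubertTateSevenVelu

namespace Literature.NumberTheory.EllipticCurves

namespace KubertTateM115Descent

/-! ## §1 The curve: coefficients, discriminant, tameness -/

/-- `E_{-11/5} = [-151, 9680, 242000, 0, 0]`. [cite: Kubert1976, Table 3 (N = 7)] -/
theorem curve_eq : kubertTateSeven (((-11 : ℤ) : ℚ)) (((5 : ℤ) : ℚ)) = ⟨-151, 9680, 242000, 0, 0⟩ := by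
  ext <;> simp [kubertTateSeven] <;> norm_num

/-- `Δ(E_{-11/5}) = -3032781600661176320000000` (integer model). [cite: Kubert1976, Table 3 (N = 7)] -/
theorem Δ_int : (kubertTateSeven (-11 : ℤ) 5).Δ = -3032781600661176320000000 := by
  rw [kubertTateSeven_Δ]; norm_num

/-- `E_{-11/5}` is an elliptic curve (`Δ ≠ 0`). [cite: Kubert1976, Table 3 (N = 7)] -/
theorem isElliptic : (kubertTateSeven (((-11 : ℤ) : ℚ)) (((5 : ℤ) : ℚ))).IsElliptic := by
  refine ⟨isUnit_iff_ne_zero.mpr ?_⟩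
  rw [eq_map_int (-11) 5, map_Δ, Δ_int]
  norm_num

/-- `7 ∤ Δ`: good reduction at `7`. [cite: Fisher2001FiveSevenDescent, §2] -/
theorem not_seven_dvd_Δ : ¬ (7 : ℤ) ∣ (kubertTateSeven (-11 : ℤ) 5).Δ := by
  rw [Δ_int]; norm_num

/-- `3 ∤ Δ`: good reduction at `3` (used for the rational torsion). [cite: SilvermanAEC2009, VII.3.1(b)] -/
theorem not_tor_dvd_Δ : ¬ ((3 : ℕ) : ℤ) ∣ (kubertTateSeven (-11 : ℤ) 5).Δ := by
  rw [Δ_int]; norm_num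

/-- **TAME**: every bad prime (`2, 5, 11, 41, 181`) is `≢ 1 (mod 7)`. [cite: Fisher2001FiveSevenDescent, §2] -/
theorem tame : ∀ p : ℕ, p.Prime → (p : ℤ) ∣ (kubertTateSeven (-11 : ℤ) 5).Δ → p % 7 ≠ 1 := by
  intro p hp hdvd
  rw [Δ_int] at hdvd
  have hdvdN : p ∣ 2 ^ 28 * 5 ^ 7 * 11 ^ 7 * 41 * 181 := by
    have h' : (p : ℤ) ∣ ((2 ^ 28 * 5 ^ 7 * 11 ^ 7 * 41 * 181 : ℕ) : ℤ) := by
      have e : ((2 ^ 28 * 5 ^ 7 * 11 ^ 7 * 41 * 181 : ℕ) : ℤ) = 3032781600661176320000000 := by norm_num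
      rw [e]; exact (Int.dvd_neg.mpr hdvd)
    exact Int.natCast_dvd_natCast.mp h'
  have hpi := Nat.Prime.prime hp
  rcases hpi.dvd_or_dvd hdvdN with h | h
  · rcases hpi.dvd_or_dvd h with h | h
    · rcases hpi.dvd_or_dvd h with h | h
      · rcases hpi.dvd_or_dvd h with h | h
        · have := (Nat.prime_dvd_prime_iff_eq hp Nat.prime_two).mp (hpi.dvd_of_dvd_pow h); omega
        · have := (Nat.prime_dvd_prime_iff_eq hp Nat.prime_five).mp (hpi.dvd_of_dvd_pow h); omega
      · have := (Nat.prime_dvd_prime_iff_eq hp (by norm_num : Nat.Prime 11)).mp (hpi.dvd_of_dvd_pow h); omega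
    · have := (Nat.prime_dvd_prime_iff_eq hp (by norm_num : Nat.Prime 41)).mp h; omega
  · have := (Nat.prime_dvd_prime_iff_eq hp (by norm_num : Nat.Prime 181)).mp h; omega

/-- `S = ` the prime factors of `|mn(m − n)| = 880`: `{2, 5, 11}`. [folklore] -/
private theorem primeFactors_eq : ((-11 : ℤ) * 5 * (-11 - 5)).natAbs.primeFactors = {2, 5, 11} := by
  have e : ((-11 : ℤ) * 5 * (-11 - 5)).natAbs = 2 ^ 4 * 5 * 11 := by norm_num
  rw [e]
  ext p
  simp only [Nat.mem_primeFactors, Finset.mem_insert, Finset.mem_singleton]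
  constructor
  · rintro ⟨hp, hdvd, -⟩
    have hpi := Nat.Prime.prime hp
    rcases hpi.dvd_or_dvd hdvd with h | h
    · rcases hpi.dvd_or_dvd h with h | h
      · exact Or.inl ((Nat.prime_dvd_prime_iff_eq hp Nat.prime_two).mp (hpi.dvd_of_dvd_pow h))
      · exact Or.inr (Or.inl ((Nat.prime_dvd_prime_iff_eq hp Nat.prime_five).mp h))
    · exact Or.inr (Or.inr ((Nat.prime_dvd_prime_iff_eq hp (by norm_num : Nat.Prime 11)).mp h))
  · rintro (rfl | rfl | rfl) <;> norm_num

/-! ## §2 The affine equation and the points -/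

/-- The affine equation of `E_{-11/5}`: `y ^ 2 - 151 * x * y + 242000 * y = x ^ 3 + 9680 * x ^ 2`. [cite: Kubert1976, Table 3 (N = 7)] -/
theorem nonsingular_iff (x y : ℚ) :
    (kubertTateSeven (((-11 : ℤ) : ℚ)) (((5 : ℤ) : ℚ))).toAffine.Nonsingular x y ↔
      y ^ 2 - 151 * x * y + 242000 * y = x ^ 3 + 9680 * x ^ 2 := by
  have hΔ : (kubertTateSeven (((-11 : ℤ) : ℚ)) (((5 : ℤ) : ℚ))).Δ ≠ 0 := isElliptic.isUnit.ne_zero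
  rw [← Affine.equation_iff_nonsingular_of_Δ_ne_zero hΔ, Affine.equation_iff]
  simp only [kubertTateSeven_a₁, kubertTateSeven_a₂, kubertTateSeven_a₃, kubertTateSeven_a₄,
    kubertTateSeven_a₆]
  push_cast
  constructor <;> intro h <;> linear_combination h

/-- The points `(176, 1408)`, `(-528, 7744)`, `(2800, 416000)` and the base point `2T = (-9680, -1703680)` lie on `E_{-11/5}`
(checked by `norm_num`). [folklore] -/
private theorem nonsingular_points :
    (kubertTateSeven (((-11 : ℤ) : ℚ)) (((5 : ℤ) : ℚ))).toAffine.Nonsingular (176) (1408) ∧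
    (kubertTateSeven (((-11 : ℤ) : ℚ)) (((5 : ℤ) : ℚ))).toAffine.Nonsingular (-528) (7744) ∧
    (kubertTateSeven (((-11 : ℤ) : ℚ)) (((5 : ℤ) : ℚ))).toAffine.Nonsingular (2800) (416000) ∧
    (kubertTateSeven (((-11 : ℤ) : ℚ)) (((5 : ℤ) : ℚ))).toAffine.Nonsingular (-9680) (-1703680) := by
  refine ⟨(nonsingular_iff _ _).mpr ?_, (nonsingular_iff _ _).mpr ?_, (nonsingular_iff _ _).mpr ?_, (nonsingular_iff _ _).mpr ?_⟩ <;> norm_num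

/-! ## §3 The valuation matrix -/

/-- `v_p(± p^k u) = k` for `p ∤ u` (evaluation of `padicValRat` on a factorised integer). [folklore] -/
private theorem padicValRat_eq_of_eq {p : ℕ} [hp : Fact p.Prime] {a : ℚ} (k : ℕ) {u : ℕ} (s : ℤ)
    (hs : s = 1 ∨ s = -1) (hu : ¬ p ∣ u) (h : a = s * (p : ℚ) ^ k * u) : padicValRat p a = k := by
  have hu0 : u ≠ 0 := by rintro rfl; exact hu (dvd_zero p)
  have hp0 : (p : ℚ) ≠ 0 := Nat.cast_ne_zero.mpr hp.out.ne_zero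
  have hs0 : (s : ℚ) ≠ 0 := by rcases hs with rfl | rfl <;> norm_num
  have hsv : padicValRat p (s : ℚ) = 0 := by
    rcases hs with rfl | rfl
    · simp
    · rw [Int.cast_neg, Int.cast_one, padicValRat.neg, padicValRat.one]
  rw [h, padicValRat.mul (mul_ne_zero hs0 (pow_ne_zero _ hp0)) (Nat.cast_ne_zero.mpr hu0),
    padicValRat.mul hs0 (pow_ne_zero _ hp0), hsv, padicValRat.pow (p : ℚ),
    padicValRat.self hp.out.one_lt, padicValRat.of_nat, padicValNat.eq_zero_of_not_dvd hu]
  simp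

/-- The `f_T`-values of the points (`15488`, `-10307264`, `1638400000000`) and of the base point `2T` (`-232202043392000`).
[cite: SilvermanAEC2009, Exercise 10.1(c)] -/
theorem kummerValues :
    (∀ i : Fin 3, ![(176 : ℚ), -528, 2800] i ^ 2 * ![(1408 : ℚ), 7744, 416000] i - (((5 : ℤ) : ℚ)) * ((((-11 : ℤ) : ℚ)) + (((5 : ℤ) : ℚ))) * ![(176 : ℚ), -528, 2800] i ^ 3 + (((5 : ℤ) : ℚ)) ^ 3 * (2 * (((-11 : ℤ) : ℚ)) + (((5 : ℤ) : ℚ))) * ![(176 : ℚ), -528, 2800] i * ![(1408 : ℚ), 7744, 416000] i - (((-11 : ℤ) : ℚ)) ^ 2 * (((5 : ℤ) : ℚ)) ^ 4 * ![(176 : ℚ), -528, 2800] i ^ 2 + (((-11 : ℤ) : ℚ)) ^ 2 * (((5 : ℤ) : ℚ)) ^ 6 * ![(1408 : ℚ), 7744, 416000] i = ![(15488 : ℚ), -10307264, 1638400000000] i) ∧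
    ((-9680 : ℚ) ^ 2 * (-1703680) - (((5 : ℤ) : ℚ)) * ((((-11 : ℤ) : ℚ)) + (((5 : ℤ) : ℚ))) * (-9680 : ℚ) ^ 3 + (((5 : ℤ) : ℚ)) ^ 3 * (2 * (((-11 : ℤ) : ℚ)) + (((5 : ℤ) : ℚ))) * (-9680 : ℚ) * (-1703680) - (((-11 : ℤ) : ℚ)) ^ 2 * (((5 : ℤ) : ℚ)) ^ 4 * (-9680 : ℚ) ^ 2 + (((-11 : ℤ) : ℚ)) ^ 2 * (((5 : ℤ) : ℚ)) ^ 6 * (-1703680) = (-232202043392000 : ℚ)) := by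
  refine ⟨fun i ↦ ?_, by norm_num⟩
  fin_cases i <;> simp <;> norm_num

/-- The valuations at `S = (2, 5, 11)`: rows `[[7, 0, 2], [6, 0, 5], [22, 8, 0]]` for the points and `[20, 3, 6]` for the base
point `2T`. [cite: SilvermanAEC2009, Exercise 10.1(c)] -/
theorem valuations :
    (∀ i j : Fin 3, padicValRat (![2, 5, 11] j) (![(15488 : ℚ), -10307264, 1638400000000] i) = ((![![7, 0, 2], ![6, 0, 5], ![22, 8, 0]] i j : ℕ) : ℤ)) ∧
    (∀ j : Fin 3, padicValRat (![2, 5, 11] j) ((-232202043392000 : ℚ)) = ((![20, 3, 6] j : ℕ) : ℤ)) := by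
  haveI : Fact (Nat.Prime 2) := ⟨Nat.prime_two⟩
  haveI : Fact (Nat.Prime 5) := ⟨Nat.prime_five⟩
  haveI : Fact (Nat.Prime 11) := ⟨by norm_num⟩
  refine ⟨fun i j ↦ ?_, fun j ↦ ?_⟩
  · fin_cases i <;> fin_cases j
    · exact padicValRat_eq_of_eq (p := 2) 7 (u := 121) (1) (Or.inl rfl) (by norm_num) (by norm_num)
    · exact padicValRat_eq_of_eq (p := 5) 0 (u := 15488) (1) (Or.inl rfl) (by norm_num) (by norm_num)
    · exact padicValRat_eq_of_eq (p := 11) 2 (u := 128) (1) (Or.inl rfl) (by norm_num) (by norm_num)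
    · exact padicValRat_eq_of_eq (p := 2) 6 (u := 161051) (-1) (Or.inr rfl) (by norm_num) (by norm_num)
    · exact padicValRat_eq_of_eq (p := 5) 0 (u := 10307264) (-1) (Or.inr rfl) (by norm_num) (by norm_num)
    · exact padicValRat_eq_of_eq (p := 11) 5 (u := 64) (-1) (Or.inr rfl) (by norm_num) (by norm_num)
    · exact padicValRat_eq_of_eq (p := 2) 22 (u := 390625) (1) (Or.inl rfl) (by norm_num) (by norm_num)
    · exact padicValRat_eq_of_eq (p := 5) 8 (u := 4194304) (1) (Or.inl rfl) (by norm_num) (by norm_num)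
    · exact padicValRat_eq_of_eq (p := 11) 0 (u := 1638400000000) (1) (Or.inl rfl) (by norm_num) (by norm_num)
  · fin_cases j
    · exact padicValRat_eq_of_eq (p := 2) 20 (u := 221445125) (-1) (Or.inr rfl) (by norm_num) (by norm_num)
    · exact padicValRat_eq_of_eq (p := 5) 3 (u := 1857616347136) (-1) (Or.inr rfl) (by norm_num) (by norm_num)
    · exact padicValRat_eq_of_eq (p := 11) 6 (u := 131072000) (-1) (Or.inr rfl) (by norm_num) (by norm_num)

/-- **The valuation matrix mod `7` is invertible**: with `M_{ij} = v_{q_j} f_T(P_i) − v_{q_j} f_T(2T)`,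
`M = [[1, 4, 3], [0, 4, 6], [2, 5, 1]]` mod `7` and `[[6, 5, 1], [1, 6, 3], [4, 2, 5]] · M = 1`, so `c ↦ c M` is onto `(ℤ/7)^3`. [folklore] -/
private theorem matrix_surjective : ∀ e : Fin 3 → ZMod 7, ∃ c : Fin 3 → ZMod 7, Matrix.vecMul c (Matrix.of (fun i j : Fin 3 ↦
      ((padicValRat (![2, 5, 11] j) (![(176 : ℚ), -528, 2800] i ^ 2 * ![(1408 : ℚ), 7744, 416000] i - (((5 : ℤ) : ℚ)) * ((((-11 : ℤ) : ℚ)) + (((5 : ℤ) : ℚ))) * ![(176 : ℚ), -528, 2800] i ^ 3 + (((5 : ℤ) : ℚ)) ^ 3 * (2 * (((-11 : ℤ) : ℚ)) + (((5 : ℤ) : ℚ))) * ![(176 : ℚ), -528, 2800] i * ![(1408 : ℚ), 7744, 416000] i - (((-11 : ℤ) : ℚ)) ^ 2 * (((5 : ℤ) : ℚ)) ^ 4 * ![(176 : ℚ), -528, 2800] i ^ 2 + (((-11 : ℤ) : ℚ)) ^ 2 * (((5 : ℤ) : ℚ)) ^ 6 * ![(1408 : ℚ), 7744, 416000] i) 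-
        padicValRat (![2, 5, 11] j) ((-9680 : ℚ) ^ 2 * (-1703680) - (((5 : ℤ) : ℚ)) * ((((-11 : ℤ) : ℚ)) + (((5 : ℤ) : ℚ))) * (-9680 : ℚ) ^ 3 + (((5 : ℤ) : ℚ)) ^ 3 * (2 * (((-11 : ℤ) : ℚ)) + (((5 : ℤ) : ℚ))) * (-9680 : ℚ) * (-1703680) - (((-11 : ℤ) : ℚ)) ^ 2 * (((5 : ℤ) : ℚ)) ^ 4 * (-9680 : ℚ) ^ 2 + (((-11 : ℤ) : ℚ)) ^ 2 * (((5 : ℤ) : ℚ)) ^ 6 * (-1703680)) : ℤ) : ZMod 7))) = e := by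
  have hM : Matrix.of (fun i j : Fin 3 ↦
      ((padicValRat (![2, 5, 11] j) (![(176 : ℚ), -528, 2800] i ^ 2 * ![(1408 : ℚ), 7744, 416000] i - (((5 : ℤ) : ℚ)) * ((((-11 : ℤ) : ℚ)) + (((5 : ℤ) : ℚ))) * ![(176 : ℚ), -528, 2800] i ^ 3 + (((5 : ℤ) : ℚ)) ^ 3 * (2 * (((-11 : ℤ) : ℚ)) + (((5 : ℤ) : ℚ))) * ![(176 : ℚ), -528, 2800] i * ![(1408 : ℚ), 7744, 416000] i - (((-11 : ℤ) : ℚ)) ^ 2 * (((5 : ℤ) : ℚ)) ^ 4 * ![(176 : ℚ), -528, 2800] i ^ 2 + (((-11 : ℤ) : ℚ)) ^ 2 * (((5 : ℤ) : ℚ)) ^ 6 * ![(1408 : ℚ), 7744, 416000] i) -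
        padicValRat (![2, 5, 11] j) ((-9680 : ℚ) ^ 2 * (-1703680) - (((5 : ℤ) : ℚ)) * ((((-11 : ℤ) : ℚ)) + (((5 : ℤ) : ℚ))) * (-9680 : ℚ) ^ 3 + (((5 : ℤ) : ℚ)) ^ 3 * (2 * (((-11 : ℤ) : ℚ)) + (((5 : ℤ) : ℚ))) * (-9680 : ℚ) * (-1703680) - (((-11 : ℤ) : ℚ)) ^ 2 * (((5 : ℤ) : ℚ)) ^ 4 * (-9680 : ℚ) ^ 2 + (((-11 : ℤ) : ℚ)) ^ 2 * (((5 : ℤ) : ℚ)) ^ 6 * (-1703680)) : ℤ) : ZMod 7)) =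
      !![1, 4, 3; 0, 4, 6; 2, 5, 1] := by
    ext i j
    simp only [Matrix.of_apply]
    rw [kummerValues.1 i, kummerValues.2, valuations.1 i j, valuations.2 j]
    fin_cases i <;> fin_cases j <;> decide
  have hinv : (!![6, 5, 1; 1, 6, 3; 4, 2, 5] : Matrix (Fin 3) (Fin 3) (ZMod 7)) *
      !![1, 4, 3; 0, 4, 6; 2, 5, 1] = 1 := by decide
  intro e
  refine ⟨Matrix.vecMul e !![6, 5, 1; 1, 6, 3; 4, 2, 5], ?_⟩
  rw [hM, Matrix.vecMul_vecMul, hinv, Matrix.vecMul_one]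

/-- `S` is enumerated by `![2, 5, 11]`. [folklore] -/
private theorem primeFactors_enum :
    (∀ j : Fin 3, ![2, 5, 11] j ∈ ((-11 : ℤ) * 5 * (-11 - 5)).natAbs.primeFactors) ∧
    (∀ p ∈ ((-11 : ℤ) * 5 * (-11 - 5)).natAbs.primeFactors, ∃ j : Fin 3, ![2, 5, 11] j = p) := by
  refine ⟨fun j ↦ ?_, fun p hp ↦ ?_⟩
  · rw [primeFactors_eq]; fin_cases j <;> simp
  · rw [primeFactors_eq] at hp
    simp only [Finset.mem_insert, Finset.mem_singleton] at hp
    rcases hp with rfl | rfl | rfl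
    · exact ⟨0, rfl⟩
    · exact ⟨1, rfl⟩
    · exact ⟨2, rfl⟩

/-! ## §4 The theorems -/

/-- **`t₇(E_{-11/5}) = 0`: `corank_{ℤ₇} Ш(E_{-11/5}/ℚ)[7^∞] = 0`, UNCONDITIONALLY**, by the complete
`7`-descent (`μ₇`-side box criterion of `KubertTateSevenMuDescent`, tame régime, `3` points, rank `2`).
[cite: SilvermanAEC2009, Thm. X.4.2(a)] [cite: Fisher2001FiveSevenDescent, §2] -/
theorem shaCorank_seven_eq_zero :
    haveI := isElliptic
    (kubertTateSeven (((-11 : ℤ) : ℚ)) (((5 : ℤ) : ℚ))).shaCorank 7 = 0 := by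
  haveI := isElliptic
  haveI : Fact (Nat.Prime 3) := ⟨Nat.prime_three⟩
  obtain ⟨h1, h2, h3, hb⟩ := nonsingular_points
  exact KubertTateSevenMuDescent.shaCorank_seven_eq_zero_of_matrix (-11) 5
    (toGeomPoints _ (.some (176) (1408) h1)) (fun σ ↦ smul_toGeomPoints _ σ _)
    (KubertTateSevenTorsion.fortynine_zsmul_toGeomPoints_ne_zero (-11) 5 3 (by norm_num) (by norm_num)
      not_tor_dvd_Δ (by norm_num) (by norm_num) (by norm_num))
    not_seven_dvd_Δ tame ![2, 5, 11] primeFactors_enum.1 primeFactors_enum.2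
    ![(176 : ℚ), -528, 2800] ![(1408 : ℚ), 7744, 416000]
    (fun i ↦ by fin_cases i <;> assumption)
    (fun i ↦ by fin_cases i <;> norm_num)
    (-9680) (-1703680) hb (by norm_num) matrix_surjective

/-- **`Ш(E_{-11/5}/ℚ)[7] = 0`, unconditionally.** [cite: SilvermanAEC2009, Thm. X.4.2(a)] -/
theorem sha_torsionBy_seven_eq_bot :
    haveI := isElliptic
    (kubertTateSeven (((-11 : ℤ) : ℚ)) (((5 : ℤ) : ℚ))).sha[((7 : ℕ) : ℤ)] = ⊥ := by
  haveI := isElliptic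
  haveI : Fact (Nat.Prime 3) := ⟨Nat.prime_three⟩
  obtain ⟨h1, h2, h3, hb⟩ := nonsingular_points
  exact KubertTateSevenMuDescent.sha_torsionBy_seven_eq_bot_of_matrix (-11) 5
    (toGeomPoints _ (.some (176) (1408) h1)) (fun σ ↦ smul_toGeomPoints _ σ _)
    (KubertTateSevenTorsion.fortynine_zsmul_toGeomPoints_ne_zero (-11) 5 3 (by norm_num) (by norm_num)
      not_tor_dvd_Δ (by norm_num) (by norm_num) (by norm_num))
    not_seven_dvd_Δ tame ![2, 5, 11] primeFactors_enum.1 primeFactors_enum.2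
    ![(176 : ℚ), -528, 2800] ![(1408 : ℚ), 7744, 416000]
    (fun i ↦ by fin_cases i <;> assumption)
    (fun i ↦ by fin_cases i <;> norm_num)
    (-9680) (-1703680) hb (by norm_num) matrix_surjective

/-- **`Ш(E_{-11/5}/ℚ)[7^∞] = 0`, unconditionally.** [cite: SilvermanAEC2009, Thm. X.4.2(a)] -/
theorem primaryComponent_sha_seven_eq_bot :
    haveI := isElliptic
    AddCommGroup.primaryComponent (kubertTateSeven (((-11 : ℤ) : ℚ)) (((5 : ℤ) : ℚ))).sha 7 = ⊥ := by
  haveI := isElliptic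
  haveI : Fact (Nat.Prime 3) := ⟨Nat.prime_three⟩
  obtain ⟨h1, h2, h3, hb⟩ := nonsingular_points
  exact KubertTateSevenMuDescent.primaryComponent_sha_seven_eq_bot_of_matrix (-11) 5
    (toGeomPoints _ (.some (176) (1408) h1)) (fun σ ↦ smul_toGeomPoints _ σ _)
    (KubertTateSevenTorsion.fortynine_zsmul_toGeomPoints_ne_zero (-11) 5 3 (by norm_num) (by norm_num)
      not_tor_dvd_Δ (by norm_num) (by norm_num) (by norm_num))
    not_seven_dvd_Δ tame ![2, 5, 11] primeFactors_enum.1 primeFactors_enum.2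
    ![(176 : ℚ), -528, 2800] ![(1408 : ℚ), 7744, 416000]
    (fun i ↦ by fin_cases i <;> assumption)
    (fun i ↦ by fin_cases i <;> norm_num)
    (-9680) (-1703680) hb (by norm_num) matrix_surjective

/-- **`rank E_{-11/5}(ℚ) = 2`, unconditionally** (the `7`-descent computes the rank: box full, tame,
`#E(ℚ)[7] = 7` by reduction modulo `3`). [cite: SilvermanAEC2009, Thm. X.4.2 and Thm. X.1.1] -/
theorem mordellWeilRank_eq :
    haveI := isElliptic
    (kubertTateSeven (((-11 : ℤ) : ℚ)) (((5 : ℤ) : ℚ))).mordellWeilRank = 2 := by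
  haveI := isElliptic
  haveI : Fact (Nat.Prime 3) := ⟨Nat.prime_three⟩
  obtain ⟨h1, h2, h3, hb⟩ := nonsingular_points
  have h := KubertTateSevenMuDescent.mordellWeilRank_succ_eq_of_matrix (-11) 5
    (toGeomPoints _ (.some (176) (1408) h1)) (fun σ ↦ smul_toGeomPoints _ σ _)
    (KubertTateSevenTorsion.fortynine_zsmul_toGeomPoints_ne_zero (-11) 5 3 (by norm_num) (by norm_num)
      not_tor_dvd_Δ (by norm_num) (by norm_num) (by norm_num))
    not_seven_dvd_Δ tame ![2, 5, 11] primeFactors_enum.1 primeFactors_enum.2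
    ![(176 : ℚ), -528, 2800] ![(1408 : ℚ), 7744, 416000]
    (fun i ↦ by fin_cases i <;> assumption)
    (fun i ↦ by fin_cases i <;> norm_num)
    (-9680) (-1703680) hb (by norm_num) matrix_surjective
    (KubertTateSevenTorsion.natCard_torsionBy_seven (-11) 5 3 (by norm_num) (by norm_num) not_tor_dvd_Δ)
  have hc : (((-11 : ℤ) * 5 * (-11 - 5)).natAbs.primeFactors).card = 3 := by
    rw [primeFactors_eq]; decide
  omega

end KubertTateM115Descent

end Literature.NumberTheory.EllipticCurves

end
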